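import Literature.NumberTheory.LFunctions.RobinTFreeReduction
import Summits.Ventures.RobinTFree.RobinTFreeRemainderBounds
import Literature.NumberTheory.LFunctions.RobinMorrillPlattRange
import Literature.NumberTheory.Primality.PrattCertificates
import Mathlib.Tactic.NormNum.PowMod
import Mathlib.Tactic.ReduceModChar
import HarnessLib

/-!
# Robin's inequality holds for every 24-free integer (on Morrill–Platt's range, Büthe's and BKLNW's θ-bounds)

Cell topic `Summits/Ventures/RobinTFree` (rh-explicit ROBIN track; a NEW theorem — in print t = 21). Pure proof file. **Main theorem**
`robinInequality_of_tFree_24`: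

  `MorrillPlatt2021_cor2 → Buthe2018_thm2_theta → BroadbentEtAl2021_theta_rel_1e19 →`
  `∀ n > 5040, TFree 24 n → σ(n) < e^γ n log log n`.

In print the class of `t`-free integers on which Robin's inequality is known is `t = 21` (Axler 2023,
Thm 1.2, and Assani–Chester–Paschal 2026, Thm 2.16; before that 20: Morrill–Platt 2021, 11:
Broughan–Trudgian 2015, 7: Solé–Planat 2012, 5: CLMS 2007). The three inputs are published theorems
taken as named hypotheses (`ChebyshevThetaSqrtBounds.lean`, `RobinMorrillPlattRange.lean`); everything else is proved: the Solé–Planat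
reduction to primorials (`RobinTFreeReduction.lean`), Rosser–Schoenfeld's exact remainder in Mertens'
product (`RobinTFreeMertens.lean`), its majorants `E1`, `E2` from the θ-bounds
(`RobinTFreeRemainderBounds.lean`, this topic), and here: the primality of `p₀ = 29 996 208 012 611` (Lucas
certificate, witness `6`), the numerical evaluation at `p₀` and at `10¹⁹`, and the assembly.

The certificate (all logarithms enter through LOWER bounds only: `log p₀ ≥ 44 log 2 ≥ 30.498`,
`√p₀ ≥ 5 476 879`, `log 10¹⁹ ≥ 57 log 2 ≥ 39.5`): for a prime `q ≥ p₀`,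
`∏_{p≤q}(1 + 1/p + ⋯ + 1/p²³) ≤ (1 − 2⁻²⁴) · e^γ log q · e^{E(q)}` with `E(q) ≤ 3.6166·10⁻⁸`
(`q ≤ 10¹⁹`) resp. `≤ 1.2966·10⁻⁸`, while `log θ(q) ≥ log q − 3.5605·10⁻⁷` resp. `log q − 2.43·10⁻⁸`;
and `30.498 · (2⁻²⁴ − 3.62·10⁻⁸) = 7.1·10⁻⁷ > 3.57·10⁻⁷`. (Margin ≈ 25 % of `2⁻²⁴`; the same
certificate fails for `t = 25`, which would need the verified range extended to `≈ 5·10¹³`.)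

## References
* T. Morrill, D. Platt, Integers 21 (2021) A28. [MorrillPlatt2021]
* C. Axler, Ramanujan J. 61 (2023), Thm 1.2 (21-free). [Axler2023Robin]
* P. Solé, M. Planat, Integers 12 (2012) A65. [SolePlanat2012]
* J. Büthe, Math. Comp. 87 (2018), Thm 2. [Buthe2018]
* S. Broadbent, H. Kadiri, A. Lumley, N. Ng, K. Wilk, Math. Comp. 90 (2021), §1.2. [BKLNW2021]
-/

noncomputable section

open Real Finset
open scoped Chebyshev

namespace Summit.Ventures.RobinTFree

open Literature.NumberTheory.LFunctions Literature.NumberTheory.LFunctions.RobinTFree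

/-! ### Primality of `p₀ = 29 996 208 012 611` (Lucas certificates) -/

/-- The prime divisors of a product of four primes. [folklore] -/
theorem eq_of_prime_dvd_mul4 {q a b c d : ℕ} (hq : q.Prime) (ha : a.Prime) (hb : b.Prime)
    (hc : c.Prime) (hd : d.Prime) (h : q ∣ a * b * c * d) : q = a ∨ q = b ∨ q = c ∨ q = d := by
  rcases (Nat.Prime.dvd_mul hq).1 h with h1 | h1
  · rcases (Nat.Prime.dvd_mul hq).1 h1 with h2 | h2
    · rcases (Nat.Prime.dvd_mul hq).1 h2 with h3 | h3
      · exact Or.inl ((Nat.prime_dvd_prime_iff_eq hq ha).1 h3)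
      · exact Or.inr (Or.inl ((Nat.prime_dvd_prime_iff_eq hq hb).1 h3))
    · exact Or.inr (Or.inr (Or.inl ((Nat.prime_dvd_prime_iff_eq hq hc).1 h2)))
  · exact Or.inr (Or.inr (Or.inr ((Nat.prime_dvd_prime_iff_eq hq hd).1 h1)))

/-- `601 005 971` is prime (Lucas: witness `2`, `601 005 970 = 2·5·1867·32191`). [folklore] -/
theorem prime_601005971 : Nat.Prime 601005971 := by
  refine lucas_primality 601005971 ((2 : ℕ) : ZMod 601005971) (by norm_num; reduce_mod_char) ?_
  intro q hq hqd
  have h4 : q ∣ 2 * 5 * 1867 * 32191 := by norm_num at hqd ⊢; exact hqd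
  rcases eq_of_prime_dvd_mul4 hq Nat.prime_two Nat.prime_five (by norm_num) (by norm_num) h4 with
    rfl | rfl | rfl | rfl
  all_goals (norm_num; reduce_mod_char; decide)

/-- Morrill–Platt's `p_{999 999 476 056} = 29 996 208 012 611` is prime (Lucas: witness `6`,
`p₀ − 1 = 2·5·7·23·31·601005971`). [cite: MorrillPlatt2021, Thm 5 / Cor 2] -/
theorem prime_p0 : Nat.Prime 29996208012611 := by
  refine lucas_primality 29996208012611 ((6 : ℕ) : ZMod 29996208012611)
    (by norm_num; reduce_mod_char) ?_
  intro q hq hqd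
  have h6 : q ∣ (2 * 5 * 7 * 23) * (31 * 601005971) := by norm_num at hqd ⊢; exact hqd
  rcases (Nat.Prime.dvd_mul hq).1 h6 with h3 | h3
  · rcases eq_of_prime_dvd_mul4 hq Nat.prime_two Nat.prime_five (by norm_num) (by norm_num) h3 with
      rfl | rfl | rfl | rfl
    all_goals (norm_num; reduce_mod_char; decide)
  · rcases (Nat.Prime.dvd_mul hq).1 h3 with h4 | h4
    · obtain rfl := (Nat.prime_dvd_prime_iff_eq hq (by norm_num)).1 h4
      norm_num; reduce_mod_char; decide
    · obtain rfl := (Nat.prime_dvd_prime_iff_eq hq prime_601005971).1 h4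
      norm_num; reduce_mod_char; decide

/-! ### Numerical lower bounds -/

/-- `log p₀ ≥ 30.498` (`p₀ ≥ 2⁴⁴`, `log 2 > 0.6931471803`). [folklore] -/
theorem log_p0_ge {q : ℝ} (hq : (29996208012611 : ℝ) ≤ q) : (30.498 : ℝ) ≤ Real.log q := by
  have h2 : (2:ℝ) ^ 44 ≤ q := le_trans (by norm_num) hq
  have := Real.log_le_log (by positivity) h2
  rw [Real.log_pow] at this
  have hl2 := Real.log_two_gt_d9
  push_cast at this
  linarith

/-- `√q ≥ 5 476 879` for `q ≥ p₀`. [folklore] -/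
theorem sqrt_p0_ge {q : ℝ} (hq : (29996208012611 : ℝ) ≤ q) : (5476879 : ℝ) ≤ √q := by
  refine Real.le_sqrt_of_sq_le (le_trans (by norm_num) hq)

/-- `log 10¹⁹ ≥ 39.5` (`10¹⁹ ≥ 2⁵⁷`). [folklore] -/
theorem log_ten_pow_19_ge {q : ℝ} (hq : (10 : ℝ) ^ 19 ≤ q) : (39.5 : ℝ) ≤ Real.log q := by
  have h2 : (2:ℝ) ^ 57 ≤ q := le_trans (by norm_num) hq
  have := Real.log_le_log (by positivity) h2
  rw [Real.log_pow] at this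
  have hl2 := Real.log_two_gt_d9
  push_cast at this
  linarith

/-! ### The Dedekind product versus Mertens' product -/

/-- `dedekindFactor t p = (1 − p^{−t}) (1 − 1/p)⁻¹` for `p ≥ 2`. [cite: SolePlanat2012, §1] -/
theorem dedekindFactor_eq {t p : ℕ} (hp : 2 ≤ p) :
    dedekindFactor t p = (1 - ((p : ℝ)⁻¹) ^ t) * (1 - (p : ℝ)⁻¹)⁻¹ := by
  unfold dedekindFactor
  have hp1 : (p : ℝ)⁻¹ ≠ 1 := by
    have : (1 : ℝ) < p := by exact_mod_cast hp
    exact ne_of_lt (inv_lt_one_of_one_lt₀ this)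
  rw [geom_sum_eq hp1]
  have h1 : (p : ℝ)⁻¹ - 1 ≠ 0 := sub_ne_zero.mpr hp1
  have h2 : 1 - (p : ℝ)⁻¹ ≠ 0 := fun h => h1 (by linarith)
  rw [div_eq_mul_inv, show ((p : ℝ)⁻¹ - 1)⁻¹ = -(1 - (p : ℝ)⁻¹)⁻¹ by
    rw [← inv_neg]; congr 1; ring]
  ring

/-- `∏_{p≤q} dedekindFactor 24 p ≤ (1 − 2⁻²⁴) · ∏_{p≤q} (1 − 1/p)⁻¹` for `q ≥ 2`. [folklore] -/
theorem prod_dedekindFactor_le {q : ℕ} (hq : 2 ≤ q) :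
    ∏ p ∈ Nat.primesLE q, dedekindFactor 24 p ≤
      (1 - (2 : ℝ)⁻¹ ^ 24) * ∏ p ∈ Nat.primesLE q, (1 - (p : ℝ)⁻¹)⁻¹ := by
  have hprime : ∀ p ∈ Nat.primesLE q, p.Prime := fun p hp => (Nat.mem_primesLE.1 hp).2
  rw [Finset.prod_congr rfl fun p hp => dedekindFactor_eq (hprime p hp).two_le, Finset.prod_mul_distrib]
  refine mul_le_mul_of_nonneg_right ?_ (Finset.prod_nonneg fun p hp => ?_)
  · -- `∏ (1 − p⁻²⁴) ≤ 1 − 2⁻²⁴`: the factor at `2` times factors `≤ 1`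
    have h2 : 2 ∈ Nat.primesLE q := Nat.mem_primesLE.2 ⟨hq, Nat.prime_two⟩
    rw [← Finset.mul_prod_erase _ _ h2]
    push_cast
    refine mul_le_of_le_one_right (by norm_num) (Finset.prod_le_one (fun p hp => ?_) fun p hp => ?_)
    · have hp := (hprime p (Finset.mem_of_mem_erase hp)).pos
      have : ((p:ℝ)⁻¹) ^ 24 ≤ 1 := pow_le_one₀ (by positivity)
        (inv_le_one_of_one_le₀ (by exact_mod_cast hp))
      linarith
    · have : 0 ≤ ((p:ℝ)⁻¹) ^ 24 := by positivity
      linarith [pow_le_one₀ (n := 24) (by positivity : (0:ℝ) ≤ (p:ℝ)⁻¹)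
        (inv_le_one_of_one_le₀ (by exact_mod_cast (hprime p (Finset.mem_of_mem_erase hp)).pos))]
  · have hp2 : (2 : ℝ) ≤ p := by exact_mod_cast (hprime p hp).two_le
    have : (p : ℝ)⁻¹ ≤ 1 / 2 := by rw [inv_eq_one_div]; exact one_div_le_one_div_of_le (by norm_num) hp2
    have : 0 < 1 - (p : ℝ)⁻¹ := by linarith
    positivity

/-! ### The analytic inequality at primorials `q#`, `q ≥ p₀` -/

/-- `E1(c, q) ≤ 3.69·10⁻⁸` for `p₀ ≤ q` and `0 ≤ c ≤ 4·10⁻⁵`. [folklore] -/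
theorem E1_le {c q : ℝ} (hc0 : 0 ≤ c) (hc : c ≤ 4e-5) (hq : (29996208012611 : ℝ) ≤ q) :
    E1 c q ≤ 3.69e-8 := by
  have hL := log_p0_ge hq
  have hs := sqrt_p0_ge hq
  have hLX := log_ten_pow_19_ge (le_refl ((10:ℝ) ^ 19))
  have hL0 : (0:ℝ) < Real.log q := by linarith
  have hs0 : (0:ℝ) < √q := by linarith
  set L := Real.log q with hLdef
  set s := √q with hsdef
  set M := Real.log ((10:ℝ) ^ 19) with hMdef
  have hM0 : (0:ℝ) < M := by linarith
  have e1 : -0.05 / (s * L) + 3.9 * (1 + L) / (s * L ^ 2) = (3.9 / L ^ 2 + 3.85 / L) / s := by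
    field_simp; ring
  have b3 : (3.9 / L ^ 2 + 3.85 / L) / s ≤ (3.9 / 30.498 ^ 2 + 3.85 / 30.498) / 5476879 := by
    calc (3.9 / L ^ 2 + 3.85 / L) / s ≤ (3.9 / L ^ 2 + 3.85 / L) / 5476879 := by gcongr
      _ ≤ _ := by gcongr
  have b4 : bklnwTail c M ≤ 4e-5 * (1 / (2 * 39.5 ^ 2) + 1 / (3 * 39.5 ^ 3)) := by
    unfold bklnwTail
    calc c * (1 / (2 * M ^ 2) + 1 / (3 * M ^ 3)) ≤ c * (1 / (2 * 39.5 ^ 2) + 1 / (3 * 39.5 ^ 3)) := by gcongr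
      _ ≤ 4e-5 * (1 / (2 * 39.5 ^ 2) + 1 / (3 * 39.5 ^ 3)) := by gcongr
  unfold E1
  rw [← hLdef, ← hsdef, ← hMdef, e1]
  have : (3.9 / 30.498 ^ 2 + 3.85 / 30.498) / 5476879 +
      4e-5 * (1 / (2 * 39.5 ^ 2) + 1 / (3 * 39.5 ^ 3)) ≤ (3.69e-8 : ℝ) := by norm_num
  linarith

/-- `E2(c, q) ≤ 1.37·10⁻⁸` for `q ≥ 10¹⁹` and `0 ≤ c ≤ 4·10⁻⁵`. [folklore] -/
theorem E2_le {c q : ℝ} (hc0 : 0 ≤ c) (hc : c ≤ 4e-5) (hq : (10:ℝ) ^ 19 ≤ q) : E2 c q ≤ 1.37e-8 := by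
  have hL := log_ten_pow_19_ge hq
  have hL0 : (0:ℝ) < Real.log q := by linarith
  unfold E2
  calc c * (4 / (3 * Real.log q ^ 3) + 1 / (2 * Real.log q ^ 2))
      ≤ c * (4 / (3 * 39.5 ^ 3) + 1 / (2 * 39.5 ^ 2)) := by gcongr
    _ ≤ 4e-5 * (4 / (3 * 39.5 ^ 3) + 1 / (2 * 39.5 ^ 2)) := by gcongr
    _ ≤ 1.37e-8 := by norm_num

/-- **The analytic inequality at primorials**: under Büthe's and BKLNW's θ-bounds, for every prime
`q ≥ p₀ = 29 996 208 012 611`, `∏_{p≤q} (1 + 1/p + ⋯ + 1/p²³) < e^γ log θ(q)`, i.e.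
`e^{−γ} R₂₄(q#) < 1` (Solé–Planat / Axler criterion at `t = 24`, with Büthe 2018 / BKLNW 2021 in
place of the inputs used in print; new). -/
theorem primorial_bound_24 (hB : Buthe2018_thm2_theta) {c : ℝ} (hc0 : 0 ≤ c) (hc : c ≤ 4e-5)
    (hK : ThetaRelBound c) {q : ℕ} (hq : q.Prime) (hq0 : 29996208012611 ≤ q) :
    ∏ p ∈ Nat.primesLE q, dedekindFactor 24 p <
      Real.exp eulerMascheroniConstant * Real.log (θ (q : ℝ)) := by
  have hqR : (29996208012611 : ℝ) ≤ q := by exact_mod_cast hq0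
  have hq2 : (2 : ℝ) ≤ q := le_trans (by norm_num) hqR
  have hq1423 : (1423 : ℝ) ≤ q := le_trans (by norm_num) hqR
  have hq1 : (1 : ℝ) < q := by linarith
  have hL := log_p0_ge hqR
  have hs := sqrt_p0_ge hqR
  have hL0 : 0 < Real.log (q:ℝ) := by linarith
  have hs0 : 0 < √(q:ℝ) := by linarith
  set L := Real.log (q : ℝ) with hLdef
  -- two elementary inequalities: `exp E ≤ 1 + E + E²` (`|E| ≤ 1`) and `log(1 − u) ≥ −u/(1 − u)` (`u < 1`)
  have exp_le_quad : ∀ {E : ℝ}, |E| ≤ 1 → Real.exp E ≤ 1 + E + E ^ 2 := fun {E} hE => by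
    have := Real.abs_exp_sub_one_sub_id_le hE
    have := (abs_le.1 this).2
    linarith
  have log_one_sub_ge : ∀ {u : ℝ}, u < 1 → -(u / (1 - u)) ≤ Real.log (1 - u) := fun {u} hu1 => by
    have hpos : 0 < 1 - u := by linarith
    have := Real.one_sub_inv_le_log_of_pos hpos
    have e : 1 - (1 - u)⁻¹ = -(u / (1 - u)) := by field_simp; ring
    linarith [e]
  -- Mertens with remainder
  have hint := integrableOn_theta_sub_mul_weight_Ioi hK hq1
  have hM := prod_one_sub_inv_inv_le hq2 hint
  rw [Nat.floor_natCast] at hM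
  have hD := prod_dedekindFactor_le (q := q) (by exact_mod_cast hq.two_le)
  have hγ : 0 < Real.exp eulerMascheroniConstant := Real.exp_pos _
  set P := ∏ p ∈ Nat.primesLE q, (1 - (p : ℝ)⁻¹)⁻¹ with hPdef
  set E := mertensRemainder (q : ℝ) with hEdef
  have c24 : (1 - (2 : ℝ)⁻¹ ^ 24) = 1 - 5.9604644775390625e-8 := by norm_num
  by_cases hcase : (q : ℝ) ≤ (10:ℝ) ^ 19
  · -- Büthe regime
    have hE : E ≤ 3.69e-8 := (mertensRemainder_le_E1 hB hK hq1423 hcase).trans (E1_le hc0 hc hqR)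
    have hexp : Real.exp E ≤ 1 + 3.69e-8 + 3.69e-8 ^ 2 := by
      have hE' : |E| ≤ 1 ∨ E < -1 := by
        by_cases h : -1 ≤ E
        · exact Or.inl (abs_le.2 ⟨h, by linarith⟩)
        · exact Or.inr (by linarith)
      rcases hE' with h | h
      · calc Real.exp E ≤ 1 + E + E ^ 2 := exp_le_quad h
          _ ≤ 1 + 3.69e-8 + 3.69e-8 ^ 2 := by nlinarith [abs_le.1 h]
      · calc Real.exp E ≤ Real.exp 0 := Real.exp_le_exp.2 (by linarith)
          _ ≤ _ := by norm_num
    -- θ(q) ≥ q − 1.95 √q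
    have hθ : (q : ℝ) - 1.95 * √(q:ℝ) ≤ θ (q : ℝ) := by linarith [hB.1 (q:ℝ) hq1423 hcase]
    have hu : 1.95 / √(q:ℝ) ≤ 1.95 / 5476879 := by gcongr
    have hu1 : 1.95 / √(q:ℝ) < 1 := lt_of_le_of_lt hu (by norm_num)
    have hu0 : 0 ≤ 1.95 / √(q:ℝ) := by positivity
    have e : (q : ℝ) - 1.95 * √(q:ℝ) = (q:ℝ) * (1 - 1.95 / √(q:ℝ)) := by
      have hsq : (q:ℝ) = √(q:ℝ) * √(q:ℝ) := (Real.mul_self_sqrt (by linarith)).symm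
      have hdiv : (q:ℝ) / √(q:ℝ) = √(q:ℝ) := by rw [div_eq_iff hs0.ne']; exact hsq
      calc (q : ℝ) - 1.95 * √(q:ℝ) = (q:ℝ) - 1.95 * ((q:ℝ) / √(q:ℝ)) := by rw [hdiv]
        _ = (q:ℝ) * (1 - 1.95 / √(q:ℝ)) := by ring
    have hθpos : 0 < (q : ℝ) - 1.95 * √(q:ℝ) := by
      rw [e]; exact mul_pos (by linarith) (by linarith)
    have hlogθ : L + Real.log (1 - 1.95 / √(q:ℝ)) ≤ Real.log (θ (q:ℝ)) := by
      calc L + Real.log (1 - 1.95 / √(q:ℝ)) = Real.log ((q:ℝ) * (1 - 1.95 / √(q:ℝ))) := by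
            rw [Real.log_mul (by linarith) (by linarith)]
        _ ≤ Real.log (θ (q:ℝ)) := Real.log_le_log (by rw [← e]; exact hθpos) (by rw [← e]; exact hθ)
    have hlog1 : -((1.95 / 5476879) / (1 - 1.95 / 5476879)) ≤ Real.log (1 - 1.95 / √(q:ℝ)) := by
      refine le_trans ?_ (log_one_sub_ge hu1)
      have : (1.95 / √(q:ℝ)) / (1 - 1.95 / √(q:ℝ)) ≤ (1.95 / 5476879) / (1 - 1.95 / 5476879) := by
        gcongr
      linarith
    -- assemble: LHS ≤ (1−2⁻²⁴) e^γ L e^E < e^γ (L − c₀) ≤ e^γ log θ(q)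
    have hP0 : 0 ≤ P := by
      refine Finset.prod_nonneg fun p hp => ?_
      have hp2 : (2 : ℝ) ≤ p := by exact_mod_cast (Nat.mem_primesLE.1 hp).2.two_le
      have : (p : ℝ)⁻¹ ≤ 1 / 2 := by rw [inv_eq_one_div]; exact one_div_le_one_div_of_le (by norm_num) hp2
      have : 0 < 1 - (p : ℝ)⁻¹ := by linarith
      positivity
    have key : (1 - 5.9604644775390625e-8) * (L * (1 + 3.69e-8 + 3.69e-8 ^ 2)) <
        L - (1.95 / 5476879) / (1 - 1.95 / 5476879) := by
      have hc : (0:ℝ) < 1 - (1 - 5.9604644775390625e-8) * (1 + 3.69e-8 + 3.69e-8 ^ 2) := by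
        norm_num
      have h1 := mul_le_mul_of_nonneg_left hL hc.le
      have h2 : (1.95 / 5476879) / (1 - 1.95 / 5476879) <
          (1 - (1 - 5.9604644775390625e-8) * (1 + 3.69e-8 + 3.69e-8 ^ 2)) * (30.498:ℝ) := by
        norm_num
      linarith
    calc ∏ p ∈ Nat.primesLE q, dedekindFactor 24 p
        ≤ (1 - (2 : ℝ)⁻¹ ^ 24) * P := hD
      _ ≤ (1 - (2 : ℝ)⁻¹ ^ 24) * (Real.exp eulerMascheroniConstant * L * Real.exp E) :=
          mul_le_mul_of_nonneg_left hM (by norm_num)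
      _ ≤ (1 - (2 : ℝ)⁻¹ ^ 24) * (Real.exp eulerMascheroniConstant * L * (1 + 3.69e-8 + 3.69e-8 ^ 2)) := by
          gcongr
      _ = Real.exp eulerMascheroniConstant * ((1 - 5.9604644775390625e-8) * (L * (1 + 3.69e-8 + 3.69e-8 ^ 2))) := by
          rw [c24]; ring
      _ < Real.exp eulerMascheroniConstant * (L - (1.95 / 5476879) / (1 - 1.95 / 5476879)) :=
          mul_lt_mul_of_pos_left key hγ
      _ ≤ Real.exp eulerMascheroniConstant * Real.log (θ (q:ℝ)) :=
          mul_le_mul_of_nonneg_left (by linarith) hγ.le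
  · -- BKLNW regime, `q > 10¹⁹`
    push Not at hcase
    have hX : (10:ℝ) ^ 19 ≤ q := hcase.le
    have hLX := log_ten_pow_19_ge hX
    have hE : E ≤ 1.37e-8 := (mertensRemainder_le_E2 hK hX).trans (E2_le hc0 hc hX)
    have hexp : Real.exp E ≤ 1 + 1.37e-8 + 1.37e-8 ^ 2 := by
      have hE' : |E| ≤ 1 ∨ E < -1 := by
        by_cases h : -1 ≤ E
        · exact Or.inl (abs_le.2 ⟨h, by linarith⟩)
        · exact Or.inr (by linarith)
      rcases hE' with h | h
      · calc Real.exp E ≤ 1 + E + E ^ 2 := exp_le_quad h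
          _ ≤ 1 + 1.37e-8 + 1.37e-8 ^ 2 := by nlinarith [abs_le.1 h]
      · calc Real.exp E ≤ Real.exp 0 := Real.exp_le_exp.2 (by linarith)
          _ ≤ _ := by norm_num
    -- θ(q) ≥ q (1 − c/L²)
    have hq0' : (0:ℝ) < q := by linarith
    have hK' : |θ (q:ℝ) - q| < c / L ^ 2 * q := by
      calc |θ (q:ℝ) - q| < c * q / Real.log q ^ 2 := hK q hX
        _ = c / L ^ 2 * q := by rw [hLdef]; ring
    have hv : c / L ^ 2 ≤ 4e-5 / 39.5 ^ 2 := by gcongr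
    have hv1 : c / L ^ 2 < 1 := lt_of_le_of_lt hv (by norm_num)
    have hv0 : 0 ≤ c / L ^ 2 := by positivity
    have hθ : (q:ℝ) * (1 - c / L ^ 2) ≤ θ (q:ℝ) := by
      have h2 := (abs_lt.1 hK').1
      have h3 : (q:ℝ) * (1 - c / L ^ 2) = q - c / L ^ 2 * q := by ring
      rw [h3]; linarith
    have hθpos : 0 < (q:ℝ) * (1 - c / L ^ 2) := mul_pos hq0' (by linarith)
    have hlogθ : L + Real.log (1 - c / L ^ 2) ≤ Real.log (θ (q:ℝ)) := by
      calc L + Real.log (1 - c / L ^ 2) = Real.log ((q:ℝ) * (1 - c / L ^ 2)) := by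
            rw [Real.log_mul (by linarith) (by linarith)]
        _ ≤ Real.log (θ (q:ℝ)) := Real.log_le_log hθpos hθ
    have hlog1 : -((4e-5 / 39.5 ^ 2) / (1 - 4e-5 / 39.5 ^ 2)) ≤ Real.log (1 - c / L ^ 2) := by
      refine le_trans ?_ (log_one_sub_ge hv1)
      have : (c / L ^ 2) / (1 - c / L ^ 2) ≤ (4e-5 / 39.5 ^ 2) / (1 - 4e-5 / 39.5 ^ 2) := by
        gcongr
      linarith
    have hP0 : 0 ≤ P := by
      refine Finset.prod_nonneg fun p hp => ?_
      have hp2 : (2 : ℝ) ≤ p := by exact_mod_cast (Nat.mem_primesLE.1 hp).2.two_le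
      have : (p : ℝ)⁻¹ ≤ 1 / 2 := by rw [inv_eq_one_div]; exact one_div_le_one_div_of_le (by norm_num) hp2
      have : 0 < 1 - (p : ℝ)⁻¹ := by linarith
      positivity
    have key : (1 - 5.9604644775390625e-8) * (L * (1 + 1.37e-8 + 1.37e-8 ^ 2)) <
        L - (4e-5 / 39.5 ^ 2) / (1 - 4e-5 / 39.5 ^ 2) := by
      have hc : (0:ℝ) < 1 - (1 - 5.9604644775390625e-8) * (1 + 1.37e-8 + 1.37e-8 ^ 2) := by
        norm_num
      have hLL : (39.5:ℝ) ≤ L := hLX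
      have h1 := mul_le_mul_of_nonneg_left hLL hc.le
      have h2 : (4e-5 / 39.5 ^ 2) / (1 - 4e-5 / 39.5 ^ 2) <
          (1 - (1 - 5.9604644775390625e-8) * (1 + 1.37e-8 + 1.37e-8 ^ 2)) * (39.5:ℝ) := by
        norm_num
      linarith
    calc ∏ p ∈ Nat.primesLE q, dedekindFactor 24 p
        ≤ (1 - (2 : ℝ)⁻¹ ^ 24) * P := hD
      _ ≤ (1 - (2 : ℝ)⁻¹ ^ 24) * (Real.exp eulerMascheroniConstant * L * Real.exp E) :=
          mul_le_mul_of_nonneg_left hM (by norm_num)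
      _ ≤ (1 - (2 : ℝ)⁻¹ ^ 24) * (Real.exp eulerMascheroniConstant * L * (1 + 1.37e-8 + 1.37e-8 ^ 2)) := by
          gcongr
      _ = Real.exp eulerMascheroniConstant * ((1 - 5.9604644775390625e-8) * (L * (1 + 1.37e-8 + 1.37e-8 ^ 2))) := by
          rw [c24]; ring
      _ < Real.exp eulerMascheroniConstant * (L - (4e-5 / 39.5 ^ 2) / (1 - 4e-5 / 39.5 ^ 2)) :=
          mul_lt_mul_of_pos_left key hγ
      _ ≤ Real.exp eulerMascheroniConstant * Real.log (θ (q:ℝ)) :=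
          mul_le_mul_of_nonneg_left (by linarith) hγ.le

/-! ### Assembly -/

/-- Robin's inequality for every 24-free `n > 5040` from Morrill–Platt's range, Büthe's θ-bounds and
ANY relative bound `|θ(x) − x| < c·x/log²x` (`x ≥ 10¹⁹`) with `0 ≤ c ≤ 4·10⁻⁵` (covers BKLNW's display
constant `3.79·10⁻⁵` and their tabulated `3.7979·10⁻⁵`). The range `5040 < n < 13#` is the tree's
certificate (`MorrillPlatt2021_cor2.robinInequality_of_le`). [folklore] -/
theorem robinInequality_of_tFree_24_of_thetaRelBound (hMP : MorrillPlatt2021_cor2)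
    (hB : Buthe2018_thm2_theta) {c : ℝ} (hc0 : 0 ≤ c) (hc : c ≤ 4e-5) (hK : ThetaRelBound c) :
    ∀ n : ℕ, 5040 < n → TFree 24 n → robinInequality n := by
  exact robinInequality_of_tFree_of_primorial_bound (t := 24) (by norm_num) prime_p0
    (fun q hq hq0 => primorial_bound_24 hB hc0 hc hK hq hq0) fun n hn hlt => hMP.robinInequality_of_le hn hlt.le

/-- **Robin's inequality holds for every 24-free integer `n > 5040`**, on Morrill–Platt's verified
range (Cor 2: `13# ≤ n ≤ 29 996 208 012 611#`), Büthe's Theorem 2 (`0.05√x < x − θ(x) ≤ 1.95√x` on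
`[1423, 10¹⁹]`) and Broadbent–Kadiri–Lumley–Ng–Wilk's display `|θ(x) − x|/x < 3.79·10⁻⁵/log²x`
(`x ≥ 10¹⁹`; any constant `≤ 4·10⁻⁵` works, see `robinInequality_of_tFree_24_of_thetaRelBound` — in
particular BKLNW's tabulated `3.7979·10⁻⁵`). In print the class is `t = 21` (Axler 2023, Thm 1.2;
Assani–Chester–Paschal 2026, Thm 2.16); this `t = 24` statement is the rh-explicit ROBIN track's
certificate → theorem (new; method of Solé–Planat 2012 / Morrill–Platt 2021 / Axler 2023 with
Büthe 2018 and BKLNW 2021 as inputs). -/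
theorem robinInequality_of_tFree_24 (hMP : MorrillPlatt2021_cor2) (hB : Buthe2018_thm2_theta)
    (hK : BroadbentEtAl2021_theta_rel_1e19) :
    ∀ n : ℕ, 5040 < n → TFree 24 n → robinInequality n :=
  robinInequality_of_tFree_24_of_thetaRelBound hMP hB (by norm_num) (by norm_num) (thetaRelBound_of_bklnw hK)

/-- `t`-free integers for `t ≤ 24` are `24`-free, so the theorem covers every rung `t ≤ 24` (in
particular the printed ones `t = 5, 7, 11, 20, 21`). [folklore] -/
theorem tFree_mono {t t' n : ℕ} (h : t ≤ t') (hn : TFree t n) : TFree t' n :=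
  fun p hp hdvd => hn p hp (dvd_trans (pow_dvd_pow p h) hdvd)

/-- **Robin's inequality on every `t`-free class with `t ≤ 24`** (same hypotheses). [folklore] -/
theorem robinInequality_of_tFree_le_24 (hMP : MorrillPlatt2021_cor2) (hB : Buthe2018_thm2_theta)
    (hK : BroadbentEtAl2021_theta_rel_1e19) {t : ℕ} (ht : t ≤ 24) :
    ∀ n : ℕ, 5040 < n → TFree t n → robinInequality n :=
  fun n hn htf => robinInequality_of_tFree_24 hMP hB hK n hn (tFree_mono ht htf)

end Summit.Ventures.RobinTFree
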